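import Literature.NumberTheory.GelbartRogawski1991.CMSplittingCharLocalComponents
import HarnessLib

/-!
# The local component `μ_v` ([Liu2021, Def. 4.11] `μ = ⊗ μ_v`) of a global splitting character on
`E_v = L ⊗_{L⁺} L⁺_v = ∏_{w ∣ v} L_w`, with the three properties [Liu2021, App. D §D.1 Step 2] prints at `(E, F) := (E_v, F_v)`

Topic `NumberTheory/GelbartRogawski1991`; namespace
`Literature.NumberTheory.GelbartRogawski1991.UnitaryDualPair.LocalSplitting` (sibling of
`CMSplittingCharLocalComponents`).  KERNEL ONLY: one definition with body (`localMu`) and theorems; no record, no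
named fact, no `sorry`.

For a CM field `L` (maximal totally real subfield `L⁺`, complex conjugation `c`), a Hecke character `χ` of `L` and
a finite place `v` of `L⁺`: [Liu2021, Def. 4.11 (FJcycle.tex l. 2086)] factors its automorphic character as
«`μ = ⊗ μ_v : E^× \ 𝔸_E^× → ℂ^×` (whose value is necessarily in `ℂ^1`)», and the local construction
[Liu2021, App. D §D.1 Step 2 (l. 5219)], stated for a LOCAL field `F` and an étale `F`-algebra `E` of rank 2
(l. 5213), reads «Choose a character `μ : E^× → ℂ^1` such that `μ|_{F^×}` is the unique character whose kernel is
exactly `Nm_{E/F} E^×`»; at the place `v` it is applied with `(E, F) := (E_v, F_v)`, `E_v = L ⊗_{L⁺} L⁺_v`, to the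
component `μ_v` (as Def. 4.11 does at l. 2092, forming «the local oscillator representation» of `G(F_v)` «introduced in
Subsection» D.1).  Those printed properties of `μ_v` (unitary, continuous, kernel of `μ_v|_{F_v^×}` = `Nm E_v^×`) are
the three fields `norm_mu`, `continuous_mu`,
`mu_algebraMap_eq_one_iff` of the tree's as-printed datum `Liu2021.LemD1Data` (`Liu2021/LemD1AsPrinted.lean`), carried
as the HYPOTHESES `μ`, `hμn`, `hμc`, `hμF` of `Def411WeilCarriers.localLemD1Data` /
`Def411WeilCarriers.rho_isIrreducible_of_lemD1AsPrinted` (`Liu2021/Def411IrreducibleOfLemD1AsPrinted.lean` §5) and of the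
COR-CM row-9 junction `Model.hirr_of_lemD1AsPrinted_row9`.  This file CONSTRUCTS that datum from `χ` and PROVES the
three properties when `χ|_{𝕀_{L⁺}} = ε_{L/L⁺}` (`IsSplittingChar L 1 χ`; e.g. Liu's `μ` read as a Hecke character —
[Liu2021, Def. 4.1 (l. 1900–1902)] «We say that `μ` is conjugate orthogonal (resp. conjugate symplectic) if
`μ|_{𝔸_F^×} = 1` (resp. `μ|_{𝔸_F^×} = μ_{E/F}`)», and the `μ` of Def. 4.11 is conjugate symplectic):

* `localMu L χ v : (LocalRing L v)ˣ →* ℂˣ`, `x ↦ ∏_{w ∣ v} χ_w(x_w)` — the local component of `χ` at `v` read on the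
  tree's `UnitaryGroup.LocalRing L v = ∏_{w ∣ v} L_w` (`localMu_apply`);
* `norm_localMu` — `‖μ_v(x)‖ = 1` for `χ` unitary (`hμn`);
* `continuous_localMu` — `x ↦ μ_v(x)` is continuous (`hμc`);
* `localMu_toLocalRing` — on `L⁺_v^×`: `μ_v(ι_v a) = χ(⟨a⟩_v ⊗ 1) = ε_{L/L⁺}(⟨a⟩_v)` (`ideleBaseChange_localUnits`,
  the splitting condition);
* `exists_mul_conjLocal_eq_iff` — `(∃ z ∈ E_v^×, z z^c = ι_v a) ↔ ∃ p q ∈ L⁺_v, p² − δ² q² = a`, in the coordinates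
  `E_v = L⁺_v ⊕ L⁺_v δ` of `QuadraticLocalBaseChange` (`δ = imagUnit L`, `c δ = −δ`);
* **`localMu_toLocalRing_eq_one_iff`** — `μ_v(ι_v a) = 1 ↔ ∃ z ∈ E_v^×, z z^c = ι_v a` (`hμF`): both sides say
  «`a` is a local norm from `L⁺_v(√θ) = L⁺_v(δ)`» (`quadraticHeckeChar_localUnits_eq_one_iff_mem`, `δ² = θ t²`).

So at `χ := OmegaMuSplitting.chiMu F ι₁ Φ` (unitary, `IsSplittingChar`) the four binders `μ hμn hμc hμF` of the
row-9 junction are inhabited by tree terms; nothing of [Liu2021] is asserted.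

## References
* [Liu2021] Y. Liu, Camb. J. Math. 9 (2021) = arXiv:2102.11518: Def. 4.1 (FJcycle.tex l. 1900–1902), Def. 4.11 (l. 2086),
  App. D §D.1 (local set-up l. 5213; Step 2 l. 5219 = arXiv PDF p. 76).
* [HarrisKudlaSweet1996] M. Harris, S. Kudla, W. Sweet, J. AMS 9 (1996), §1 (1.5), (1.15).
* [CasselsFrohlichANT1967] J. W. S. Cassels, A. Fröhlich (eds.), Algebraic Number Theory (1967), Ch. II §10–§11, Ch. VII §4.3.
* [Omeara1963] O. T. O'Meara, Introduction to Quadratic Forms (1963), §63B, §65A.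
-/

set_option autoImplicit false

noncomputable section

open NumberField IsDedekindDomain Filter
open Literature.NumberTheory.Automorphic Literature.NumberTheory.Automorphic.UnitaryGroup
open Literature.NumberTheory.GaloisRepresentations Literature.NumberTheory.QuadraticForms
open Literature.RepresentationTheory.HarrisKudlaSweet1996

namespace Literature.NumberTheory.GelbartRogawski1991.UnitaryDualPair.LocalSplitting

section CM

variable (L : Type) [Field L] [NumberField L] [IsCMField L]

local notation3 "cc" => (IsCMField.complexConj L)
local notation3 "L⁺" => (↥(maximalRealSubfield L))

variable (χ : HeckeCharacter L) (v : HeightOneSpectrum (𝓞 (maximalRealSubfield L)))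

/-! ## §1 The local character `μ_v = ∏_{w ∣ v} χ_w` on `E_v^× = (∏_{w ∣ v} L_w)^×` -/

omit [IsCMField L] in
/-- **the local component `μ_v` of [Liu2021, Def. 4.11 (l. 2086)] «`μ = ⊗ μ_v`»** (= the `μ` of [App. D §D.1 Step 2
(l. 5219)] at `(E, F) := (E_v, F_v)`) for a Hecke character `χ` of the CM field `L` at a finite place `v` of `L⁺`: the
character `x ↦ ∏_{w ∣ v} χ_w(x_w)` of `E_v^× = (∏_{w ∣ v} L_w)^×` (`χ_w = χ.localComponent w`).
[cite: Liu2021, App. D §D.1 Step 2 (l. 5219)] [cite: CasselsFrohlichANT1967, Ch. VII §4.3] -/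
def localMu : (LocalRing L v)ˣ →* ℂˣ :=
  ∏ w : PlacesOver L v,
    (χ.localComponent w.1).comp (Units.map (Pi.evalMonoidHom (fun w : PlacesOver L v => w.1.adicCompletion L) w))

omit [IsCMField L] in
/-- unfolding: `μ_v(x) = ∏_{w ∣ v} χ(⟨x_w⟩_w)`. [cite: Liu2021, App. D §D.1 Step 2 (l. 5219)] -/
theorem localMu_apply (x : (LocalRing L v)ˣ) :
    localMu L χ v x = ∏ w : PlacesOver L v,
      χ (localUnits w.1 (Units.map (Pi.evalMonoidHom (fun w : PlacesOver L v => w.1.adicCompletion L) w) x)) := by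
  simp only [localMu, MonoidHom.finsetProd_apply, MonoidHom.coe_comp, Function.comp_apply,
    HeckeCharacter.localComponent_apply]

omit [IsCMField L] in
/-- **`hμn`: `μ_v` is unitary** when `χ` is (`‖χ(x)‖ = 1` on idèles). [cite: Liu2021, App. D §D.1 Step 2 (l. 5219)] -/
theorem norm_localMu (hχu : χ.IsUnitary) (x : (LocalRing L v)ˣ) : ‖((localMu L χ v x : ℂˣ) : ℂ)‖ = 1 := by
  rw [localMu_apply, Units.coe_prod, norm_prod]
  exact Finset.prod_eq_one fun w _ => hχu _

omit [IsCMField L] in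
/-- **`hμc`: `μ_v` is continuous** (`χ_w` continuous, `x ↦ x_w` continuous). [cite: Liu2021, App. D §D.1 Step 2 (l. 5219)] -/
theorem continuous_localMu : Continuous fun x => ((localMu L χ v x : ℂˣ) : ℂ) := by
  have h : (fun x => ((localMu L χ v x : ℂˣ) : ℂ)) = fun x => ∏ w : PlacesOver L v,
      (((χ.localComponent w.1) (Units.map (Pi.evalMonoidHom (fun w : PlacesOver L v => w.1.adicCompletion L) w) x) : ℂˣ) : ℂ) := by
    funext x
    rw [localMu, MonoidHom.finsetProd_apply, Units.coe_prod]
    rfl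
  rw [h]
  refine continuous_finsetProd _ fun w _ => ?_
  exact Units.continuous_val.comp ((HeckeCharacter.continuous_localComponent χ w.1).comp
    (Continuous.units_map _ (continuous_apply w)))

/-! ## §2 `μ_v` on `L⁺_v^×`: the splitting condition read place by place -/

omit [IsCMField L] in
/-- the `w`-component of `ι_v a` is `ι_w a` (units form). [cite: CasselsFrohlichANT1967, Ch. II §10] -/
theorem units_map_eval_toLocalRing (a : (v.adicCompletion L⁺)ˣ) (w : PlacesOver L v) :
    Units.map (Pi.evalMonoidHom (fun w : PlacesOver L v => w.1.adicCompletion L) w)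
        (Units.map (toLocalRing L v : v.adicCompletion L⁺ →* LocalRing L v) a) =
      Units.map (toPlace v w : v.adicCompletion L⁺ →* w.1.adicCompletion L) a :=
  Units.ext rfl

omit [IsCMField L] in
/-- **`χ(⟨a⟩_v ⊗ 1) = ∏_{w ∣ v} χ_w(ι_w a) = μ_v(ι_v a)`**: the base change of the local idèle `⟨a⟩_v` is
`∏_{w ∣ v} ⟨ι_w a⟩_w` (`ideleBaseChange_localUnits`). [cite: CasselsFrohlichANT1967, Ch. VII §4.3] -/
theorem localMu_toLocalRing_eq_ideleBaseChange (a : (v.adicCompletion L⁺)ˣ) :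
    localMu L χ v (Units.map (toLocalRing L v : v.adicCompletion L⁺ →* LocalRing L v) a) =
      χ (AdeleRing.ideleBaseChange L⁺ L (localUnits v a)) := by
  classical
  have hT : ∀ w' : HeightOneSpectrum (𝓞 L),
      w' ∈ (Finset.univ : Finset (PlacesOver L v)).map (Function.Embedding.subtype _) ↔
        w'.under (𝓞 L⁺) = v := fun w' => by
    constructor
    · intro h
      obtain ⟨w, -, rfl⟩ := Finset.mem_map.1 h
      exact w.2
    · intro h
      exact Finset.mem_map.2 ⟨⟨w', h⟩, Finset.mem_univ _, rfl⟩
  have h := ideleBaseChange_localUnits (F := L⁺) (E := L) v a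
    (fun w' => if h : w'.under (𝓞 L⁺) = v then
      Units.map (toPlace v ⟨w', h⟩ : v.adicCompletion L⁺ →* w'.adicCompletion L) a else 1)
    (fun w' h _ => by rw [dif_pos h, Units.coe_map]; rfl) _ hT
  rw [h, Finset.prod_map, map_prod, localMu_apply]
  refine Finset.prod_congr rfl fun w _ => ?_
  obtain ⟨w, hw⟩ := w
  rw [units_map_eval_toLocalRing]
  congr 2
  dsimp only [Function.Embedding.coe_subtype]
  rw [dif_pos hw]
  rfl

/-- **`μ_v(ι_v a) = ε_{L/L⁺}(⟨a⟩_v)`** for a splitting character (`χ|_{𝕀_{L⁺}} = ε`).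
[cite: HarrisKudlaSweet1996, §1 (1.5), (1.15)] -/
theorem localMu_toLocalRing (hχ : IsSplittingChar L 1 χ) (a : (v.adicCompletion L⁺)ˣ) :
    localMu L χ v (Units.map (toLocalRing L v : v.adicCompletion L⁺ →* LocalRing L v) a) =
      quadraticHeckeChar L⁺ (cmQuadraticGenerator L) (not_isSquare_cmQuadraticGenerator L) (localUnits v a) := by
  rw [localMu_toLocalRing_eq_ideleBaseChange, hχ, pow_one, quadraticHeckeCharCM_def]

/-! ## §3 Local norms from `E_v = L⁺_v ⊕ L⁺_v δ` -/

/-- `δ² = θ t²` in `L⁺` with `t ≠ 0` (`δ = imagUnit L`, `θ = cmQuadraticGenerator L`; `δ / √θ ∈ L⁺`). [folklore] -/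
private theorem exists_imagUnitSq_eq_generator_mul_sq :
    ∃ t : L⁺, t ≠ 0 ∧ (imagUnitSq L : L⁺) = (cmQuadraticGenerator L : L⁺) * t ^ 2 := by
  obtain ⟨α, hα0, hαc, hα⟩ := cmQuadraticGenerator_spec L
  have ht : cc (imagUnit L / α) = imagUnit L / α := by
    rw [map_div₀, complexConj_imagUnit, hαc, neg_div_neg_eq]
  refine ⟨⟨imagUnit L / α, (IsCMField.complexConj_eq_self_iff L _).1 ht⟩, fun h => ?_, ?_⟩
  · have h' : imagUnit L / α = 0 := congrArg Subtype.val h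
    exact div_ne_zero (imagUnit_ne_zero L) hα0 h'
  · apply (algebraMap L⁺ L).injective
    rw [map_mul, map_pow, ← imagUnit_mul_self, ← hα]
    change imagUnit L * imagUnit L = α ^ 2 * (imagUnit L / α) ^ 2
    field_simp

/-- `z z^c = ι_v(p² − δ² q²)` for `z = ι_v p + ι_v q · δ`. [cite: CasselsFrohlichANT1967, Ch. II §10] -/
theorem quadraticLocalEquiv_mul_conjLocal (p q : v.adicCompletion L⁺) :
    quadraticLocalEquiv L v cc (complexConj_imagUnit L) (imagUnit_ne_zero L) (p, q) *
        conjLocal L cc v (quadraticLocalEquiv L v cc (complexConj_imagUnit L) (imagUnit_ne_zero L) (p, q)) =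
      toLocalRing L v (p ^ 2 - (imagUnitSq L : L⁺) * q ^ 2) := by
  rw [conjLocal_quadraticLocalEquiv, quadraticLocalEquiv_apply, quadraticLocalEquiv_apply]
  dsimp only
  have hd : algebraMap L (LocalRing L v) (imagUnit L) * algebraMap L (LocalRing L v) (imagUnit L) =
      toLocalRing L v ((imagUnitSq L : L⁺) : v.adicCompletion L⁺) := by
    rw [← map_mul, imagUnit_mul_self, toLocalRing_coe]
  rw [map_neg, map_sub, map_pow, map_mul (toLocalRing L v), ← hd, map_pow]
  ring

/-- **local norms in coordinates**: `(∃ z ∈ E_v^×, z z^c = ι_v a) ↔ ∃ p q ∈ L⁺_v, p² − δ² q² = a` (`a ≠ 0`).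
[cite: CasselsFrohlichANT1967, Ch. II §10] [cite: Omeara1963, §63B] -/
theorem exists_mul_conjLocal_eq_iff (a : (v.adicCompletion L⁺)ˣ) :
    (∃ z : (LocalRing L v)ˣ, (z : LocalRing L v) * conjLocal L cc v z = toLocalRing L v a) ↔
      ∃ p q : v.adicCompletion L⁺, p ^ 2 - (imagUnitSq L : L⁺) * q ^ 2 = a := by
  constructor
  · rintro ⟨z, hz⟩
    obtain ⟨⟨p, q⟩, hpq, -⟩ := existsUnique_eq_add_mul L v cc (complexConj_imagUnit L) (imagUnit_ne_zero L) (z : LocalRing L v)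
    refine ⟨p, q, toLocalRing_injective L v ?_⟩
    rw [← quadraticLocalEquiv_mul_conjLocal, quadraticLocalEquiv_apply]
    dsimp only
    rw [← hpq, hz]
  · rintro ⟨p, q, h⟩
    have hu : IsUnit (quadraticLocalEquiv L v cc (complexConj_imagUnit L) (imagUnit_ne_zero L) (p, q)) := by
      refine isUnit_of_mul_isUnit_left (y := conjLocal L cc v
        (quadraticLocalEquiv L v cc (complexConj_imagUnit L) (imagUnit_ne_zero L) (p, q))) ?_
      rw [quadraticLocalEquiv_mul_conjLocal, h]
      exact (a.isUnit.map (toLocalRing L v))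
    refine ⟨hu.unit, ?_⟩
    rw [IsUnit.unit_spec, quadraticLocalEquiv_mul_conjLocal, h]

/-- the two coordinate norm forms agree: `δ² = θ t²`. [cite: Omeara1963, §63B] -/
theorem exists_sq_sub_imagUnitSq_mul_sq_iff (a : v.adicCompletion L⁺) :
    (∃ p q : v.adicCompletion L⁺, p ^ 2 - (imagUnitSq L : L⁺) * q ^ 2 = a) ↔
      ∃ x y : v.adicCompletion L⁺, x ^ 2 - ((cmQuadraticGenerator L : L⁺) : v.adicCompletion L⁺) * y ^ 2 = a := by
  obtain ⟨t, ht0, ht⟩ := exists_imagUnitSq_eq_generator_mul_sq L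
  have htv : ((imagUnitSq L : L⁺) : v.adicCompletion L⁺) =
      ((cmQuadraticGenerator L : L⁺) : v.adicCompletion L⁺) * ((t : v.adicCompletion L⁺)) ^ 2 := by
    have h := congrArg (algebraMap L⁺ (v.adicCompletion L⁺)) ht
    rw [map_mul, map_pow] at h
    exact h
  have ht0v : (t : v.adicCompletion L⁺) ≠ 0 := (map_ne_zero (algebraMap L⁺ (v.adicCompletion L⁺))).2 ht0
  constructor
  · rintro ⟨p, q, h⟩
    exact ⟨p, (t : v.adicCompletion L⁺) * q, by rw [← h, htv]; ring⟩
  · rintro ⟨x, y, h⟩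
    exact ⟨x, y / (t : v.adicCompletion L⁺), by rw [← h, htv]; field_simp⟩

/-! ## §4 `hμF`: `μ_v(ι_v a) = 1 ↔ a ∈ Nm E_v^×` -/

/-- **`hμF` — [Liu2021, App. D §D.1 Step 2 (l. 5219)] «`μ|_{F^×}` is the unique character whose kernel is exactly
`Nm_{E/F} E^×`» (printed for a local field `F`, l. 5213), instantiated at `(E, F) := (E_v, F_v)`**, for
`μ_v := localMu L χ v`, `χ` a splitting character: for `a ∈ L⁺_v^×`,
`μ_v(ι_v a) = 1 ↔ ∃ z ∈ E_v^×, z z^c = ι_v a`.  Both sides say that `a` is a norm from `L⁺_v(√θ) = L⁺_v(δ)`: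
the left through `μ_v(ι_v a) = ε(⟨a⟩_v)` and `quadraticHeckeChar_localUnits_eq_one_iff_mem`, the right through the
coordinates `E_v = L⁺_v ⊕ L⁺_v δ`. [cite: Liu2021, App. D §D.1 Step 2 (l. 5219)] [cite: Omeara1963, §63B, §65A] -/
theorem localMu_toLocalRing_eq_one_iff (hχ : IsSplittingChar L 1 χ) (a : (v.adicCompletion L⁺)ˣ) :
    localMu L χ v (Units.map (algebraMap (v.adicCompletion L⁺) (LocalRing L v)).toMonoidHom a) = 1 ↔
      ∃ z : (LocalRing L v)ˣ, (z : LocalRing L v) * conjLocal L cc v z =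
        algebraMap (v.adicCompletion L⁺) (LocalRing L v) a := by
  rw [algebraMap_localRing_eq, exists_mul_conjLocal_eq_iff, exists_sq_sub_imagUnitSq_mul_sq_iff]
  change localMu L χ v (Units.map (toLocalRing L v : v.adicCompletion L⁺ →* LocalRing L v) a) = 1 ↔ _
  rw [localMu_toLocalRing L χ v hχ, quadraticHeckeChar_localUnits_eq_one_iff_mem]
  rfl

end CM

end Literature.NumberTheory.GelbartRogawski1991.UnitaryDualPair.LocalSplitting

end
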